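import Summits.PneNP.PneNP.Theorems.ChebyshevTracialDesignJuntaCount
import HarnessLib

/-!
# Junta virtual positivity, part B: the pattern-law polynomial and the junta sum law

Support file for the crux `TracialDecayExp20` (stmt-PneNP-19878) of route `ChebyshevTracialDesign`
(cell pnp-psdrank, local virtual positivity lemma (N1), HOME/pnp-psdrank-p1/N1-LocalVirtualPositivity.md,
Lemma 1 "pattern law" (iii) and Lemma 2). Builds on part A (`ChebyshevTracialDesignJuntaCount`).

* `pattern_poly_exists`: for a full local pattern with `x` window edges, `y` crossing and `z` internal,
  the ratio `T(N-x; c-y, i-z)/T(N; c, i)` along the levels `c + 2i = t` is `P(c)` for a real polynomial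
  `P = 2^{-y}[X]_y ∏_{j<z}((t-X)/2-j) ∏_{j<x-y-z}(N-(t+X)/2-j)/[N]_x` of degree `≤ x` with `P(0) ≥ 0`
  (in the range `2x ≤ t+2`, `2x+t ≤ 2N+2`); the `ℕ` identity behind it is `T_ratio_nat`.
* `junta_sum_law`: for a perfect matching `M` of `S`, window edges `E ⊆ M` covering `W`, and `G` a function
  of `U ⊆ S` depending (on `t`-sets) only on `U ∩ W` with nonnegative values, the level sums
  `Σ_{U : c crossing, i internal} G(U)` equal `T(|M|; c, i)·P(c)` for one polynomial `P` of degree `≤ |E|`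
  with `P(0) ≥ 0`.

No definitions; notation as in part A's docstring (`T(m;a,b) = C(m,a+b)·C(a+b,b)·2^a`).
-/

set_option linter.dupNamespace false -- `Summit.PneNP.PneNP.…`: summit = sub-problem (D-0017)

namespace Summit.PneNP.PneNP.Theorems.ChebyshevTracialDesignJunta

open Finset Literature.Barriers.PneNP Literature.Combinatorics.SimpleGraph.CycleSpace

variable {V : Type*} [DecidableEq V]

/-! ### The pattern-law polynomial (part B)

For a full local pattern with `x` window edges of which `y` are crossing and `z` internal, the conditional
probability at crossing level `c` (with `i = (t-c)/2` internal edges in total, `N = n/2` edges) is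
`T(N-x; c-y, i-z) / T(N; c, i) = 2^{-y}[c]_y[i]_z[N-c-i]_{x-y-z}/[N]_x`, the value at `c` of a real
polynomial of degree `≤ x` whose value at the virtual level `c = 0` is `≥ 0`
(cell pnp-psdrank (N1) Lemma 1; HOME/pnp-psdrank-p1/N1-LocalVirtualPositivity.md). -/

section PatternLaw

open Polynomial

/-- `[n]_k = ∏_{j<k} (n - j)` in `ℝ` for `k ≤ n`. [folklore] -/
theorem cast_descFactorial_eq_prod {n k : ℕ} (h : k ≤ n) :
    ((n.descFactorial k : ℕ) : ℝ) = ∏ j ∈ range k, ((n : ℝ) - j) := by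
  rw [Nat.descFactorial_eq_prod_range, Nat.cast_prod]
  refine prod_congr rfl fun j hj => ?_
  have := mem_range.1 hj
  rw [Nat.cast_sub (by omega)]

/-- `T(m;a,b)·a!·b!·(m-a-b)! = m!·2^a` for `a + b ≤ m`. [folklore] -/
theorem T_mul_factorial {m a b : ℕ} (h : a + b ≤ m) :
    m.choose (a + b) * (a + b).choose b * 2 ^ a * (a.factorial * b.factorial * (m - (a + b)).factorial) =
      m.factorial * 2 ^ a := by
  have h1 := Nat.choose_mul_factorial_mul_factorial h
  have h2 := Nat.choose_mul_factorial_mul_factorial (Nat.le_add_left b a)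
  rw [Nat.add_sub_cancel] at h2
  calc m.choose (a + b) * (a + b).choose b * 2 ^ a * (a.factorial * b.factorial * (m - (a + b)).factorial)
      = m.choose (a + b) * ((a + b).choose b * b.factorial * a.factorial) * (m - (a + b)).factorial * 2 ^ a := by
        ring
    _ = m.choose (a + b) * (a + b).factorial * (m - (a + b)).factorial * 2 ^ a := by rw [h2]
    _ = m.factorial * 2 ^ a := by rw [h1]

/-- **The ratio identity in `ℕ`**: `T(N-x; c-y, i-z)·2^y·[N]_x = T(N; c, i)·[c]_y·[i]_z·[N-c-i]_{x-y-z}`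
in the non-degenerate range. [folklore] -/
theorem T_ratio_nat {N x y z c i : ℕ} (hx : x ≤ N) (hyz : y + z ≤ x) (hyc : y ≤ c) (hzi : z ≤ i)
    (hci : c + i ≤ N) (he : x - y - z ≤ N - c - i) :
    (N - x).choose (c - y + (i - z)) * (c - y + (i - z)).choose (i - z) * 2 ^ (c - y) *
        (2 ^ y * N.descFactorial x) =
      N.choose (c + i) * (c + i).choose i * 2 ^ c *
        (c.descFactorial y * i.descFactorial z * (N - c - i).descFactorial (x - y - z)) := by
  -- multiply both sides by `K = (c-y)! (i-z)! (N-c-i-(x-y-z))!`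
  have hK : 0 < (c - y).factorial * (i - z).factorial * (N - c - i - (x - y - z)).factorial := by positivity
  refine Nat.eq_of_mul_eq_mul_right hK ?_
  have hL : c - y + (i - z) ≤ N - x := by omega
  have eL : N - x - (c - y + (i - z)) = N - c - i - (x - y - z) := by omega
  have hA := T_mul_factorial hL
  rw [eL] at hA
  have hB := T_mul_factorial hci
  have eB : N - (c + i) = N - c - i := by omega
  rw [eB] at hB
  have hNx := Nat.factorial_mul_descFactorial hx
  have hcy := Nat.factorial_mul_descFactorial hyc
  have hiz := Nat.factorial_mul_descFactorial hzi
  have hNe := Nat.factorial_mul_descFactorial he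
  have hpow : 2 ^ (c - y) * 2 ^ y = 2 ^ c := by rw [← pow_add, Nat.sub_add_cancel hyc]
  calc (N - x).choose (c - y + (i - z)) * (c - y + (i - z)).choose (i - z) * 2 ^ (c - y) *
        (2 ^ y * N.descFactorial x) * ((c - y).factorial * (i - z).factorial * (N - c - i - (x - y - z)).factorial)
      = ((N - x).choose (c - y + (i - z)) * (c - y + (i - z)).choose (i - z) * 2 ^ (c - y) *
          ((c - y).factorial * (i - z).factorial * (N - c - i - (x - y - z)).factorial)) *
          (2 ^ y * N.descFactorial x) := by ring
    _ = (N - x).factorial * 2 ^ (c - y) * (2 ^ y * N.descFactorial x) := by rw [hA]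
    _ = ((N - x).factorial * N.descFactorial x) * (2 ^ (c - y) * 2 ^ y) := by ring
    _ = N.factorial * 2 ^ c := by rw [hNx, hpow]
    _ = N.choose (c + i) * (c + i).choose i * 2 ^ c * (c.factorial * i.factorial * (N - c - i).factorial) := hB.symm
    _ = N.choose (c + i) * (c + i).choose i * 2 ^ c *
          (((c - y).factorial * c.descFactorial y) * ((i - z).factorial * i.descFactorial z) *
            ((N - c - i - (x - y - z)).factorial * (N - c - i).descFactorial (x - y - z))) := by
        rw [hcy, hiz, hNe]
    _ = N.choose (c + i) * (c + i).choose i * 2 ^ c *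
          (c.descFactorial y * i.descFactorial z * (N - c - i).descFactorial (x - y - z)) *
          ((c - y).factorial * (i - z).factorial * (N - c - i - (x - y - z)).factorial) := by ring

/-- **Pattern-law polynomial** (cell (N1) Lemma 1): for `x ≤ N` window edges with `y + z ≤ x`, in the range
`2x ≤ t + 2`, `2x + t ≤ 2N + 2`, there is a real polynomial `P` of degree `≤ x` with `P(0) ≥ 0` such that
for every level `c` with `c + 2i = t`: `T(N-x; c-y, i-z) = T(N; c, i) · P(c)` (the left side read as `0`
when `y > c` or `z > i`). Explicitly
`P = 2^{-y}[X]_y · ∏_{j<z}((t-X)/2 - j) · ∏_{j<x-y-z}(N - (t+X)/2 - j) / [N]_x`. [folklore] -/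
theorem pattern_poly_exists (N t : ℕ) {x y z : ℕ} (hx : x ≤ N) (hyz : y + z ≤ x)
    (ht : 2 * x ≤ t + 2) (hn : 2 * x + t ≤ 2 * N + 2) :
    ∃ P : Polynomial ℝ, P.natDegree ≤ x ∧ 0 ≤ P.eval 0 ∧
      ∀ c i : ℕ, c + 2 * i = t →
        (((if y ≤ c ∧ z ≤ i then
            (N - x).choose (c - y + (i - z)) * (c - y + (i - z)).choose (i - z) * 2 ^ (c - y) else 0 : ℕ)) : ℝ) =
          ((N.choose (c + i) * (c + i).choose i * 2 ^ c : ℕ) : ℝ) * P.eval (c : ℝ) := by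
  set κ : ℝ := ((2 : ℝ) ^ y * (N.descFactorial x : ℝ))⁻¹ with hκ
  have hNx : 0 < (N.descFactorial x : ℝ) := by
    have : N.descFactorial x ≠ 0 := fun h0 => by
      rw [Nat.descFactorial_eq_zero_iff_lt] at h0; omega
    positivity
  have hκ0 : 0 ≤ κ := by rw [hκ]; positivity
  refine ⟨C κ * (∏ j ∈ range y, (X - C (j : ℝ))) * (∏ j ∈ range z, (C ((t : ℝ) / 2 - j) - C (1 / 2) * X)) *
      ∏ j ∈ range (x - y - z), (C ((N : ℝ) - (t : ℝ) / 2 - j) - C (1 / 2) * X), ?_, ?_, ?_⟩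
  · -- degree
    have h1 : (∏ j ∈ range y, (X - C (j : ℝ))).natDegree ≤ y := by
      refine (natDegree_prod_le _ _).trans ?_
      refine (sum_le_sum fun (j : ℕ) _ => (natDegree_X_sub_C ((j : ℕ) : ℝ)).le).trans ?_
      simp
    have hlin : ∀ a : ℝ, (C a - C (1 / 2 : ℝ) * X).natDegree ≤ 1 := fun a =>
      (natDegree_sub_le _ _).trans (max_le (by simp) ((natDegree_C_mul_le _ _).trans natDegree_X_le))
    have h2 : (∏ j ∈ range z, (C ((t : ℝ) / 2 - j) - C (1 / 2) * X)).natDegree ≤ z := by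
      refine (natDegree_prod_le _ _).trans ?_
      refine (sum_le_sum fun j _ => hlin _).trans ?_
      simp
    have h3 : (∏ j ∈ range (x - y - z), (C ((N : ℝ) - (t : ℝ) / 2 - j) - C (1 / 2) * X)).natDegree ≤ x - y - z := by
      refine (natDegree_prod_le _ _).trans ?_
      refine (sum_le_sum fun j _ => hlin _).trans ?_
      simp
    refine (natDegree_mul_le.trans (add_le_add (natDegree_mul_le.trans (add_le_add
      ((natDegree_C_mul_le _ _).trans h1) h2)) h3)).trans ?_
    omega
  · -- value at the virtual level
    simp only [eval_mul, eval_C, eval_prod, eval_sub, eval_X, mul_zero, sub_zero]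
    rcases Nat.eq_zero_or_pos y with hy0 | hy0
    · subst hy0
      simp only [range_zero, prod_empty, mul_one, Nat.sub_zero]
      refine mul_nonneg (mul_nonneg hκ0 (prod_nonneg fun j hj => ?_)) (prod_nonneg fun j hj => ?_)
      · have := mem_range.1 hj
        have : (j : ℝ) ≤ (t : ℝ) / 2 := by
          rw [le_div_iff₀ (by norm_num : (0:ℝ) < 2)]
          exact_mod_cast (by omega : j * 2 ≤ t)
        linarith
      · have := mem_range.1 hj
        have : (j : ℝ) + (t : ℝ) / 2 ≤ N := by
          have h' : 2 * j + t ≤ 2 * N := by omega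
          have h'' : (2 : ℝ) * j + t ≤ 2 * N := by exact_mod_cast h'
          linarith
        linarith
    · have : ∏ j ∈ range y, ((0 : ℝ) - (j : ℝ)) = 0 :=
        prod_eq_zero (mem_range.2 hy0) (by simp)
      rw [this]
      simp
  · -- the identity at level c
    intro c i hci
    have evC : ∀ r : ℝ, ((∏ j ∈ range z, (C ((t : ℝ) / 2 - j) - C (1 / 2) * X)).eval r) =
        ∏ j ∈ range z, (((t : ℝ) - r) / 2 - j) := fun r => by
      rw [eval_prod]; exact prod_congr rfl fun j _ => by simp; ring
    have evE : ∀ r : ℝ, ((∏ j ∈ range (x - y - z), (C ((N : ℝ) - (t : ℝ) / 2 - j) - C (1 / 2) * X)).eval r) =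
        ∏ j ∈ range (x - y - z), ((N : ℝ) - ((t : ℝ) + r) / 2 - j) := fun r => by
      rw [eval_prod]; exact prod_congr rfl fun j _ => by simp; ring
    have evY : ∀ r : ℝ, ((∏ j ∈ range y, (X - C (j : ℝ))).eval r) = ∏ j ∈ range y, (r - j) := fun r => by
      rw [eval_prod]; exact prod_congr rfl fun j _ => by simp
    rw [eval_mul, eval_mul, eval_mul, eval_C, evY, evC, evE]
    have hti : ((t : ℝ) - c) / 2 = i := by
      have : (t : ℝ) = c + 2 * i := by exact_mod_cast hci.symm
      rw [this]; ring
    have htc : ((t : ℝ) + c) / 2 = (c : ℝ) + i := by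
      have : (t : ℝ) = c + 2 * i := by exact_mod_cast hci.symm
      rw [this]; ring
    rw [hti, htc]
    by_cases hyc : y ≤ c
    · by_cases hzi : z ≤ i
      · rw [if_pos ⟨hyc, hzi⟩]
        by_cases hciN : c + i ≤ N
        · by_cases he : x - y - z ≤ N - c - i
          · -- the non-degenerate case: the ℕ identity
            have key := T_ratio_nat hx hyz hyc hzi hciN he
            have keyR : (((N - x).choose (c - y + (i - z)) * (c - y + (i - z)).choose (i - z) * 2 ^ (c - y) : ℕ) : ℝ) *
                ((2 : ℝ) ^ y * (N.descFactorial x : ℝ)) =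
                ((N.choose (c + i) * (c + i).choose i * 2 ^ c : ℕ) : ℝ) *
                  ((c.descFactorial y : ℝ) * (i.descFactorial z : ℝ) * ((N - c - i).descFactorial (x - y - z) : ℝ)) := by
              exact_mod_cast key
            have h2y : (0 : ℝ) < (2 : ℝ) ^ y * (N.descFactorial x : ℝ) := by positivity
            have keyR' := (eq_div_iff h2y.ne').2 keyR
            rw [keyR', cast_descFactorial_eq_prod hyc, cast_descFactorial_eq_prod hzi,
              cast_descFactorial_eq_prod he, hκ]
            have : ((N - c - i : ℕ) : ℝ) = (N : ℝ) - ((c : ℝ) + i) := by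
              rw [Nat.sub_sub, Nat.cast_sub hciN, Nat.cast_add]
            rw [this]
            field_simp
          · -- too many external window edges: both sides vanish
            have he' := not_le.1 he
            have hL : N - x < c - y + (i - z) := by omega
            rw [Nat.choose_eq_zero_of_lt hL]
            have hmem : N - c - i ∈ range (x - y - z) := mem_range.2 he'
            have h0 : ∏ j ∈ range (x - y - z), ((N : ℝ) - ((c : ℝ) + i) - j) = 0 := by
              refine prod_eq_zero hmem ?_
              have : ((N - c - i : ℕ) : ℝ) = (N : ℝ) - ((c : ℝ) + i) := by
                rw [Nat.sub_sub, Nat.cast_sub hciN, Nat.cast_add]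
              rw [← this]; ring
            rw [h0]; simp
        · -- `c + i > N`: both sides vanish
          have hciN' := not_le.1 hciN
          have hL : N - x < c - y + (i - z) := by omega
          rw [Nat.choose_eq_zero_of_lt hL, Nat.choose_eq_zero_of_lt hciN']
          simp
      · -- `z > i`
        rw [if_neg (fun h => hzi h.2)]
        have h0 : ∏ j ∈ range z, ((i : ℝ) - j) = 0 := prod_eq_zero (mem_range.2 (not_le.1 hzi)) (by simp)
        rw [h0]; simp
    · -- `y > c`
      rw [if_neg (fun h => hyc h.1)]
      have h0 : ∏ j ∈ range y, ((c : ℝ) - j) = 0 := prod_eq_zero (mem_range.2 (not_le.1 hyc)) (by simp)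
      rw [h0]; simp

end PatternLaw

/-! ### The junta sum law (per perfect matching)

For a perfect matching `M` of `S`, a sub-matching `E ⊆ M` (the window edges, covering `W`), and a function
`G` of `U ⊆ S` that on `t`-sets only depends on the trace `U ∩ W` (with nonnegative values `Λ`), the sums
`Σ_{U : c crossing, i internal} G(U)` along the levels `c + 2i = t` are `T(|M|; c, i) · P(c)` for one real
polynomial `P` of degree `≤ |E|` with `P(0) ≥ 0` (cell (N1) Lemma 2). -/

section SumLaw

open Polynomial

/-- Every edge of a perfect matching of `S` is internal to `S`. [folklore] -/
theorem cutCount_self_eq_two {S : Finset V} {M : Finset (Sym2 V)} (h : IsPMOn S M) {e : Sym2 V} (he : e ∈ M) :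
    cutCount S e = 2 := by
  have hS := h.subset_sym2 he
  induction e using Sym2.ind with
  | h a b =>
    rw [mem_sym2_iff] at hS
    rw [cutCount_mk, if_pos (hS a (Sym2.mem_mk_left a b)), if_pos (hS b (Sym2.mem_mk_right a b))]

/-- A perfect matching of `S` has `|S|/2` edges: `2|M| = |S|`. [folklore] -/
theorem two_mul_card_eq {S : Finset V} {M : Finset (Sym2 V)} (h : IsPMOn S M) : 2 * M.card = S.card := by
  have h0 : (M.filter fun e => cutCount S e = 1).card = 0 := by
    rw [card_eq_zero, filter_eq_empty_iff]
    intro e he h1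
    rw [cutCount_self_eq_two h he] at h1
    exact absurd h1 (by decide)
  have h2 : (M.filter fun e => cutCount S e = 2) = M := filter_true_of_mem fun e he => cutCount_self_eq_two h he
  rw [card_eq_cr_add_two_mul_in h Subset.rfl, h0, h2, zero_add]

/-- **Junta sum law** (cell (N1) Lemma 2): see the section docstring. [folklore] -/
theorem junta_sum_law {S : Finset V} {M E : Finset (Sym2 V)} (hM : IsPMOn S M) (hE : E ⊆ M) {t : ℕ}
    (ht : 2 * E.card ≤ t + 2) (hn : 2 * E.card + t ≤ 2 * M.card + 2) (G Λ : Finset V → ℝ)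
    (hG : ∀ U, U ⊆ S → U.card = t → G U = Λ (U ∩ S.filter fun v => ∃ e ∈ E, v ∈ e))
    (hΛ : ∀ B, 0 ≤ Λ B) :
    ∃ P : Polynomial ℝ, P.natDegree ≤ E.card ∧ 0 ≤ P.eval 0 ∧ ∀ c i : ℕ, c + 2 * i = t →
      ∑ U ∈ S.powerset.filter (fun U => (M.filter fun e => cutCount U e = 1).card = c ∧
          (M.filter fun e => cutCount U e = 2).card = i), G U =
        ((M.card.choose (c + i) * (c + i).choose i * 2 ^ c : ℕ) : ℝ) * P.eval (c : ℝ) := by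
  classical
  have hxN : E.card ≤ M.card := card_le_card hE
  have hyz : ∀ B : Finset V, (E.filter fun e => cutCount B e = 1).card +
      (E.filter fun e => cutCount B e = 2).card ≤ E.card := by
    intro B
    rw [← card_union_of_disjoint (disjoint_filter.2 fun e _ h1 h2 => by omega)]
    exact card_le_card (union_subset (filter_subset _ _) (filter_subset _ _))
  have hP : ∀ B : Finset V, ∃ P : Polynomial ℝ, P.natDegree ≤ E.card ∧ 0 ≤ P.eval 0 ∧
      ∀ c i : ℕ, c + 2 * i = t →
        (((if (E.filter fun e => cutCount B e = 1).card ≤ c ∧ (E.filter fun e => cutCount B e = 2).card ≤ i then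
            (M.card - E.card).choose (c - (E.filter fun e => cutCount B e = 1).card +
                (i - (E.filter fun e => cutCount B e = 2).card)) *
              (c - (E.filter fun e => cutCount B e = 1).card +
                (i - (E.filter fun e => cutCount B e = 2).card)).choose
                  (i - (E.filter fun e => cutCount B e = 2).card) *
              2 ^ (c - (E.filter fun e => cutCount B e = 1).card) else 0 : ℕ)) : ℝ) =
          ((M.card.choose (c + i) * (c + i).choose i * 2 ^ c : ℕ) : ℝ) * P.eval (c : ℝ) :=
    fun B => pattern_poly_exists M.card t hxN (hyz B) ht hn
  choose P hPdeg hP0 hPval using hP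
  set W := S.filter fun v => ∃ e ∈ E, v ∈ e with hW
  refine ⟨∑ B ∈ W.powerset, C (Λ B) * P B, ?_, ?_, ?_⟩
  · exact natDegree_sum_le_of_forall_le _ _ fun B _ => (natDegree_C_mul_le _ _).trans (hPdeg B)
  · rw [eval_finsetSum]
    exact sum_nonneg fun B _ => by rw [eval_mul, eval_C]; exact mul_nonneg (hΛ B) (hP0 B)
  · intro c i hci
    rw [← sum_fiberwise_of_maps_to (g := fun U => U ∩ W) (t := W.powerset)
      (fun U _ => mem_powerset.2 inter_subset_right), eval_finsetSum, mul_sum]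
    refine sum_congr rfl fun B hB => ?_
    have hconst : ∀ U ∈ (S.powerset.filter fun U => (M.filter fun e => cutCount U e = 1).card = c ∧
        (M.filter fun e => cutCount U e = 2).card = i).filter (fun U => U ∩ W = B), G U = Λ B := by
      intro U hU
      simp only [mem_filter, mem_powerset] at hU
      obtain ⟨⟨hUS, hc, hi⟩, hUW⟩ := hU
      rw [hG U hUS (by rw [card_eq_cr_add_two_mul_in hM hUS, hc, hi, hci]), hUW]
    rw [sum_congr rfl hconst, sum_const, nsmul_eq_mul, filter_filter]
    have hfib := card_fiber_eq hM hE (mem_powerset.1 hB) c i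
    rw [← hW] at hfib
    have hset : (S.powerset.filter fun U => ((M.filter fun e => cutCount U e = 1).card = c ∧
          (M.filter fun e => cutCount U e = 2).card = i) ∧ U ∩ W = B) =
        S.powerset.filter fun U => (M.filter fun e => cutCount U e = 1).card = c ∧
          (M.filter fun e => cutCount U e = 2).card = i ∧ U ∩ W = B :=
      filter_congr fun U _ => and_assoc
    rw [hset, hfib, hPval B c i hci, eval_mul, eval_C]
    ring

end SumLaw

end Summit.PneNP.PneNP.Theorems.ChebyshevTracialDesignJunta
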